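/-
Origin: expansion seat `planner-pub-hodgecm-pv02-g8-0`, handover #3 2026-08-18T15:03:02Z (md5 f679efdf7f0e77b6f720b887eabe0dcb, 311 l., 31 decls; NEW additive KERNEL leaf; imports tree HodgeCM.Automorphic.WeilThetaModelHeisenbergAdjoin (r28) + my #1 => ONE rewrite `import Pv02g8.WeilThetaModelDerivCalculus` -> `import HodgeCM.Automorphic.WeilThetaModelDerivCalculus`; land AFTER my #1 (6dd90978); HOLD iff #1 held; independent of #2) (`HOME/pub-hodgecm-pv02-g8/lean/Pv02g8/WeilThetaModelAdjoinCenter.lean`, md5 f679efdf, 311 lines);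
landed by the gen-8 packager in gate run 31 as `HodgeCM/Automorphic/WeilThetaModelAdjoinCenter.lean` (import ^import Pv02g8\.WeilThetaModelDerivCalculus[ \t]*$→import HodgeCM.Automorphic.WeilThetaModelDerivCalculus ×1).
-/
import Summits.HodgeConjecture.HodgeCM.Automorphic.WeilThetaModelHeisenbergAdjoin_2
import Summits.HodgeConjecture.HodgeCM.Automorphic.WeilThetaModelDerivCalculus_2

/-
  HodgeCM/Automorphic/WeilThetaModelAdjoinCenter.lean   (seat of origin: pub-hodgecm-pv02-g8, DAG-NODE PROVER #02
  generation 8, lane (A); WIP module `Pv02g8.WeilThetaModelAdjoinCenter`, session planner-pub-hodgecm-pv02-g8-0,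
  2026-08-18).  PACKAGER: ONE rewrite `import Pv02g8.WeilThetaModelDerivCalculus` ↦
  `import HodgeCM.Automorphic.WeilThetaModelDerivCalculus` (this seat's handover #1, RUN 31); the other import is the
  tree module `HodgeCM.Automorphic.WeilThetaModelHeisenbergAdjoin` (gate run 28); lands AFTER handover #1.  KERNEL only: nothing cited enters as a hypothesis, nothing is
  asserted, no placeholders.

# The centre ⧹ (Heisenberg ⋊ D) Weil theta model: NON-CENTRAL group elements, incl. ADJOINED ones, acting through `ω`

## What and why (lane A = linear structure + Weil-topology derivatives of Weil theta models)

Every Weil theta model in the tree lets `ω(h) = s(1, h)` act either through the CENTRE (`schrodingerModel`,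
`heisenbergModel`, `heisenbergAdjoinModel`, `heisenbergWeylModel`: `G = U(1)`) or through the Heisenberg group
(`centerModel`: `G = Heis V`, `ω = ρ_m`).  The `smooth` clause of the S4 record ([SETUP D5′], pv11-g9
`LinSmoothSide.smooth`, pv06-g7 `HypSmoothSide.hF`) is about `s ↦ ω(e(s))Φ` along one-parameter subgroups of
`U(W_b)` that are NOT central and, at the places `b ∈ Σ₁₂`, NOT compact.  pv14-g5's
`WeilThetaModelHeisenbergAdjoin` (gate run 28) adjoins an arbitrary DISCRETE group `D` of intertwiners
`π : D →* (𝓢(V, ℂ) →L[ℂ] 𝓢(V, ℂ))ˣ` of `ρ_m` along `φ : D →* MulAut (Heis V)` — but on the `G_U`-side: the adjoined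
elements are theta-VARIABLES there, `ω` is still central.

THIS FILE swaps the roles (as `centerModel` did for `heisenbergModel`):

* `HeisSD.centralSplittingSD hφc : U(1) × (Heis V ⋊[φ] D) →* Heis V ⋊[φ] D`, `(z, x) ↦ c(z)·x` (§1);
* `datumSDstab hc` (§2): pv14-g5's datum `(Heis V ⋊[φ] D, 𝓢(V, ℂ), ρ̃, ·, Θ̃)` with the rational points taken to be
  the full STABILISER `thetaStabSD` of the theta distribution — so that Weil's Théorème 6 (left invariance) holds
  by definition of the stabiliser and NO hypothesis `FixesTheta π` is needed: adjoined elements that do NOT fix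
  the theta distribution of `L` (dilations!) are allowed — they are simply not rational;
* **`adjoinCenterModel hφc hc Γz hΓz Γ hΓ : WeilThetaModel U(1) Γz (Heis V ⋊[φ] D) Γ`** (§3) for any
  `Γz ⊆ μ_m` and any `Γ ≤ thetaStabSD` (e.g. `inl(arith L m)`, `inl_mem_thetaStabSD`): `ω(x) = ρ̃(x) = ρ_m(x.left) ∘
  π_{x.right}` — the adjoined elements ACT THROUGH `ω` (`adjoinCenterModel_omg`, `adjoinCenterModel_omg_inr :
  ω(inr d)Φ = π_d Φ`); it is a LINEAR model (`linearStr_adjoinCenterModel`) and `ω` is multiplicative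
  (`adjoinCenterModel_omg_mul`);
* the derivative dictionary (§4): for ANY curve `d : ℝ → D` and `Φ, Ψ ∈ 𝓢(V, ℂ)`,
  **`hasSKDerivAt_adjoinCenterModel_inr_iff`**:
  `HasSKDerivAt (s ↦ ω(inr (d s)) Φ) Ψ 0 ↔ Tendsto (s ↦ ((s:ℝ):ℂ)⁻¹ • (π_{d s} Φ − π_{d 0} Φ)) (𝓝[≠] 0) (𝓝 Ψ)` in
  `𝓢(V, ℂ)` — the `smooth` clause along an adjoined one-parameter family IS the Schwartz-topology derivative of the
  operator family `π`, nothing else; and `hasSKDerivAt_adjoinCenterModel_inl_iff` (Heisenberg directions: the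
  statement of `KernelModelHeisenbergDeriv` verbatim, `ρ̃ ∘ inl = ρ_m`).

The point: with `D = ℝ` (discrete topology) acting by DILATIONS `φ_t(a, b, u) = (e^{-t}a, e^{t}b, u)`,
`π_t Φ = Φ(e^t ·)` (an intertwiner of `ρ_m` that does not fix `Θ_L`), §4 turns pv14-g6's Euler-operator theorem
`tendsto_compCLM_sub_div_ofReal` (RUN 31, `SchwartzLinearFlowDeriv`) into the FIRST model-level `smooth` clause
along a NON-COMPACT one-parameter subgroup acting through `ω` — the toy real-place instance of the hyperbolic
direction `X₁ ∈ 𝔭_b` of pv06-g7 `ArchCHyperbolic`.  That instance is the next file of this seat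
(`WeilThetaModelDilation`); this one is generic in `(D, φ, π)` and depends on no RUN-31 row.

HONEST LABEL.  `D` carries the DISCRETE topology (pv14-g5's setting: joint continuity of `ρ̃` is then that of
`ρ_m`); the derivative statements of §4 do not see the topology of `D` at all (they are about curves
`ℝ → 𝓢(V, ℂ)`), but Weil's n° 39 joint continuity for the genuine topology of a Lie group `D` is NOT claimed.  This
is a TOY real place (`Heis V ⋊ D`), not `U(W_b)(L_v) ≅ U(2,1)`; the dictionary to N29 is pv06 / pv12's.  Nothing of
PerL, QW8 or the 2001 programme is used or claimed.
-/

set_option autoImplicit false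

noncomputable section

open Topology Filter

open scoped RealInnerProductSpace SchwartzMap

namespace HodgeCM
namespace SchwartzWeil

/-! ## 1. The centre splitting `U(1) × (Heis V ⋊ D) → Heis V ⋊ D` -/

namespace HeisSD

variable {V : Type*} [NormedAddCommGroup V] [InnerProductSpace ℝ V] {D : Type*} [Group D]
  {φ : D →* MulAut (Heis V)}

/-- `(z, x) ↦ c(z) · x` — a homomorphism because `c(z)` is central (`center_mul_comm`). -/
def centralSplittingSD (hφc : ∀ (d : D) (z : Circle), φ d (Heis.center z) = Heis.center z) :
    Circle × (Heis V ⋊[φ] D) →* Heis V ⋊[φ] D :=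
  MonoidHom.mk' (fun p => center p.1 * p.2) (by
    intro p q
    simp only [Prod.fst_mul, Prod.snd_mul, map_mul, mul_assoc]
    congr 1
    rw [← mul_assoc, center_mul_comm hφc q.1 p.2, mul_assoc])

/-- (Ported verbatim from the HodgeCMPerL package; no docstring in the source.) -/
@[simp] theorem centralSplittingSD_apply (hφc : ∀ (d : D) (z : Circle), φ d (Heis.center z) = Heis.center z)
    (p : Circle × (Heis V ⋊[φ] D)) : centralSplittingSD hφc p = center p.1 * p.2 := rfl

/-- (Ported verbatim from the HodgeCMPerL package; no docstring in the source.) -/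
theorem centralSplittingSD_one_left (hφc : ∀ (d : D) (z : Circle), φ d (Heis.center z) = Heis.center z)
    (x : Heis V ⋊[φ] D) : centralSplittingSD hφc (1, x) = x := by
  rw [centralSplittingSD_apply, map_one, one_mul]

variable [TopologicalSpace D]

/-- (Ported verbatim from the HodgeCMPerL package; no docstring in the source.) -/
theorem continuous_centralSplittingSD [IsTopologicalGroup (Heis V ⋊[φ] D)]
    (hφc : ∀ (d : D) (z : Circle), φ d (Heis.center z) = Heis.center z) :
    Continuous (centralSplittingSD hφc : Circle × (Heis V ⋊[φ] D) → Heis V ⋊[φ] D) :=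
  (continuous_center.comp continuous_fst).mul continuous_snd

end HeisSD

/-! ## 2. The datum with rational points the theta stabiliser -/

section Datum

variable (V : Type) [NormedAddCommGroup V] [InnerProductSpace ℝ V] [FiniteDimensional ℝ V] [MeasurableSpace V]
  [BorelSpace V] (L : Submodule ℤ V) (m : ℤ) {D : Type} [Group D] [TopologicalSpace D]
  {φ : D →* MulAut (Heis V)} {π : D →* (𝓢(V, ℂ) →L[ℂ] 𝓢(V, ℂ))ˣ}

/-- pv14-g5's datum `(Mp, S, act, ·, Θ̃) = (Heis V ⋊[φ] D, 𝓢(V, ℂ), ρ̃, ·, Θ̃)` with `rat :=` the STABILISER of the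
theta distribution `Φ ↦ Θ_Φ(1)` under `ρ̃` (it contains `inl(arith L m)`, `inl_mem_thetaStabSD`; it contains the
adjoined `inr d` iff `π_d` fixes the theta distribution). -/
def datumSDstab (hc : Intertwines V m φ π) : Literature.Theta.WeilThetaDatum.{0} where
  Mp := Heis V ⋊[φ] D
  SX := 𝓢(V, ℂ)
  act := fun x Φ => (repSD V m hc x : 𝓢(V, ℂ) →L[ℂ] 𝓢(V, ℂ)) Φ
  rat := (thetaStabSD V L m hc : Set (Heis V ⋊[φ] D))
  theta := thetaSD V L m hc

/-- (Ported verbatim from the HodgeCMPerL package; no docstring in the source.) -/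
@[simp] theorem datumSDstab_Mp (hc : Intertwines V m φ π) : (datumSDstab V L m hc).Mp = (Heis V ⋊[φ] D) := rfl

/-- (Ported verbatim from the HodgeCMPerL package; no docstring in the source.) -/
@[simp] theorem datumSDstab_SX (hc : Intertwines V m φ π) : (datumSDstab V L m hc).SX = 𝓢(V, ℂ) := rfl

/-- (Ported verbatim from the HodgeCMPerL package; no docstring in the source.) -/
theorem datumSDstab_act (hc : Intertwines V m φ π) (x : Heis V ⋊[φ] D) (Φ : 𝓢(V, ℂ)) :
    (datumSDstab V L m hc).act x Φ = (repSD V m hc x : 𝓢(V, ℂ) →L[ℂ] 𝓢(V, ℂ)) Φ := rfl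

/-- (Ported verbatim from the HodgeCMPerL package; no docstring in the source.) -/
theorem datumSDstab_theta (hc : Intertwines V m φ π) : (datumSDstab V L m hc).theta = thetaSD V L m hc := rfl

/-- (Ported verbatim from the HodgeCMPerL package; no docstring in the source.) -/
theorem datumSDstab_rat (hc : Intertwines V m φ π) :
    (datumSDstab V L m hc).rat = (thetaStabSD V L m hc : Set (Heis V ⋊[φ] D)) := rfl

variable [DiscreteTopology D]

/-- Weil n° 39 for the datum: joint continuity of `ρ̃` (pv14-g5 `continuous_repSD_uncurry`; `D` discrete). -/
theorem actionContinuous_datumSDstab (hc : Intertwines V m φ π) : (datumSDstab V L m hc).ActionContinuous :=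
  continuous_repSD_uncurry V m hc

variable [DiscreteTopology L]

/-- Weil's Théorème 6 for the datum: `Θ̃_Φ` is continuous and left-invariant under the stabiliser — WITHOUT any
hypothesis that the adjoined operators fix the theta distribution. -/
theorem thetaContinuousInvariant_datumSDstab (hc : Intertwines V m φ π) :
    (datumSDstab V L m hc).ThetaContinuousInvariant :=
  ⟨continuous_thetaSD V L m hc, fun Φ _ hγ x => thetaSD_stab_mul V L m hc Φ hγ x⟩

end Datum

/-! ## 3. The model: `U(1)` on the theta side, `Heis V ⋊[φ] D` acting through `ω = ρ̃` -/

section Model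

variable (V : Type) [NormedAddCommGroup V] [InnerProductSpace ℝ V] [FiniteDimensional ℝ V] [MeasurableSpace V]
  [BorelSpace V] (L : Submodule ℤ V) [DiscreteTopology L] (m : ℤ) {D : Type} [Group D] [TopologicalSpace D]
  [DiscreteTopology D] {φ : D →* MulAut (Heis V)} {π : D →* (𝓢(V, ℂ) →L[ℂ] 𝓢(V, ℂ))ˣ}
  [IsTopologicalGroup (Heis V ⋊[φ] D)]

/-- **The centre ⧹ (Heisenberg ⋊ D) Weil theta model.**  prl1-g4's `WeilThetaModel U(1) Γz (Heis V ⋊[φ] D) Γ`: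
`G_U ↦ U(1)` (rational points `Γz ⊆ μ_m`), `U(W) ↦ Heis V ⋊[φ] D` ACTING by `ρ̃ = ρ_m ⋊ π` on `𝓢(V, ℂ)`,
`U(W)(L₀) ↦ Γ`, any subgroup of the theta stabiliser; every field a theorem; `SK := univ`. -/
def adjoinCenterModel (hφc : ∀ (d : D) (z : Circle), φ d (Heis.center z) = Heis.center z) (hc : Intertwines V m φ π)
    (Γz : Subgroup Circle) (hΓz : ∀ z ∈ Γz, z ^ m = 1) (Γ : Subgroup (Heis V ⋊[φ] D))
    (hΓ : Γ ≤ thetaStabSD V L m hc) :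
    HodgeCM.WeilThetaModel Circle Γz (Heis V ⋊[φ] D) Γ where
  W := datumSDstab V L m hc
  act_one := repSD_one_apply V m hc
  theta_act := fun Φ x g => thetaSD_repSD V L m hc Φ x g
  actionContinuous := actionContinuous_datumSDstab V L m hc
  thetaContinuousInvariant := thetaContinuousInvariant_datumSDstab V L m hc
  dist_cont := continuous_thetaSD_left V L m hc 1
  s := HeisSD.centralSplittingSD hφc
  s_cont := HeisSD.continuous_centralSplittingSD hφc
  s_rat := fun z hz _ hx => (thetaStabSD V L m hc).mul_mem
    (inl_mem_thetaStabSD V L m hc (center_mem_arith V L m (hΓz z hz))) (hΓ hx)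
  SK := Set.univ
  SK_stable := fun _ _ _ => Set.mem_univ _

variable (hφc : ∀ (d : D) (z : Circle), φ d (Heis.center z) = Heis.center z) (hc : Intertwines V m φ π)
  (Γz : Subgroup Circle) (hΓz : ∀ z ∈ Γz, z ^ m = 1) (Γ : Subgroup (Heis V ⋊[φ] D))
  (hΓ : Γ ≤ thetaStabSD V L m hc)

/-- (Ported verbatim from the HodgeCMPerL package; no docstring in the source.) -/
@[simp] theorem adjoinCenterModel_W :
    (adjoinCenterModel V L m hφc hc Γz hΓz Γ hΓ).W = datumSDstab V L m hc := rfl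

/-- (Ported verbatim from the HodgeCMPerL package; no docstring in the source.) -/
@[simp] theorem adjoinCenterModel_SK : (adjoinCenterModel V L m hφc hc Γz hΓz Γ hΓ).SK = Set.univ := rfl

/-- (Ported verbatim from the HodgeCMPerL package; no docstring in the source.) -/
@[simp] theorem adjoinCenterModel_s_apply (p : Circle × (Heis V ⋊[φ] D)) :
    (adjoinCenterModel V L m hφc hc Γz hΓz Γ hΓ).s p = HeisSD.center p.1 * p.2 := rfl

/-- **`ω(x)Φ = ρ̃(x)Φ = ρ_m(x.left) (π_{x.right} Φ)`**: the Weil action of the model IS pv14-g5's `ρ̃`. -/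
theorem adjoinCenterModel_omg (x : Heis V ⋊[φ] D) (Φ : (adjoinCenterModel V L m hφc hc Γz hΓz Γ hΓ).SK) :
    ((adjoinCenterModel V L m hφc hc Γz hΓz Γ hΓ).omg x Φ).1 =
      (repSD V m hc x : 𝓢(V, ℂ) →L[ℂ] 𝓢(V, ℂ)) Φ.1 := by
  have h1 : (adjoinCenterModel V L m hφc hc Γz hΓz Γ hΓ).s (1, x) = x :=
    (congrArg (· * x) (map_one (HeisSD.center (V := V) (φ := φ)))).trans (one_mul x)
  rw [WeilThetaModel.coe_omg, h1]
  exact datumSDstab_act V L m hc x Φ.1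

/-- (Ported verbatim from the HodgeCMPerL package; no docstring in the source.) -/
theorem adjoinCenterModel_omg_mk (x : Heis V ⋊[φ] D) (Φ : 𝓢(V, ℂ)) :
    (adjoinCenterModel V L m hφc hc Γz hΓz Γ hΓ).omg x ⟨Φ, Set.mem_univ Φ⟩ =
      ⟨(repSD V m hc x : 𝓢(V, ℂ) →L[ℂ] 𝓢(V, ℂ)) Φ, Set.mem_univ _⟩ :=
  Subtype.ext (adjoinCenterModel_omg V L m hφc hc Γz hΓz Γ hΓ x ⟨Φ, Set.mem_univ Φ⟩)

/-- Heisenberg elements act by `ρ_m`. -/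
theorem adjoinCenterModel_omg_inl (h : Heis V) (Φ : (adjoinCenterModel V L m hφc hc Γz hΓz Γ hΓ).SK) :
    ((adjoinCenterModel V L m hφc hc Γz hΓz Γ hΓ).omg (SemidirectProduct.inl h) Φ).1 = repCLM V m h Φ.1 := by
  rw [adjoinCenterModel_omg, repSD_inl_apply]

/-- **The adjoined elements act through `ω` by `π`**: `ω(inr d)Φ = π_d Φ`. -/
theorem adjoinCenterModel_omg_inr (d : D) (Φ : (adjoinCenterModel V L m hφc hc Γz hΓz Γ hΓ).SK) :
    ((adjoinCenterModel V L m hφc hc Γz hΓz Γ hΓ).omg (SemidirectProduct.inr d) Φ).1 =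
      (π d : 𝓢(V, ℂ) →L[ℂ] 𝓢(V, ℂ)) Φ.1 := by
  rw [adjoinCenterModel_omg, repSD_inr]

/-- (Ported verbatim from the HodgeCMPerL package; no docstring in the source.) -/
theorem adjoinCenterModel_omg_inr_mk (d : D) (Φ : 𝓢(V, ℂ)) :
    (adjoinCenterModel V L m hφc hc Γz hΓz Γ hΓ).omg (SemidirectProduct.inr d) ⟨Φ, Set.mem_univ Φ⟩ =
      ⟨(π d : 𝓢(V, ℂ) →L[ℂ] 𝓢(V, ℂ)) Φ, Set.mem_univ _⟩ :=
  Subtype.ext (adjoinCenterModel_omg_inr V L m hφc hc Γz hΓz Γ hΓ d ⟨Φ, Set.mem_univ Φ⟩)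

/-- `ω` is MULTIPLICATIVE on this model (`ρ̃` is a homomorphism) — the hypothesis `hmul` of the derivative
calculus (`WeilThetaModelDerivCalculus` §4, `WeilThetaModelDerivTransport` §2) discharged. -/
theorem adjoinCenterModel_omg_mul (x y : Heis V ⋊[φ] D) (Φ : (adjoinCenterModel V L m hφc hc Γz hΓz Γ hΓ).SK) :
    (adjoinCenterModel V L m hφc hc Γz hΓz Γ hΓ).omg (x * y) Φ =
      (adjoinCenterModel V L m hφc hc Γz hΓz Γ hΓ).omg x
        ((adjoinCenterModel V L m hφc hc Γz hΓz Γ hΓ).omg y Φ) := by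
  apply Subtype.ext
  rw [adjoinCenterModel_omg, adjoinCenterModel_omg, adjoinCenterModel_omg, repSD_mul_apply]

/-- **The model is LINEAR** (`S(X) = 𝓢(V, ℂ)`, `ρ̃(x)` linear, `Θ̃` linear in `Φ` — pv02-g7 `thetaSD_add` /
`thetaSD_smul` —, `𝒮^κ = univ`). -/
instance linearStr_adjoinCenterModel : (adjoinCenterModel V L m hφc hc Γz hΓz Γ hΓ).LinearStr where
  instACG := inferInstanceAs (AddCommGroup 𝓢(V, ℂ))
  instMod := inferInstanceAs (Module ℂ 𝓢(V, ℂ))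
  act_add := fun x Φ Ψ => (repSD V m hc x : 𝓢(V, ℂ) →L[ℂ] 𝓢(V, ℂ)).map_add Φ Ψ
  act_smul := fun x a Φ => (repSD V m hc x : 𝓢(V, ℂ) →L[ℂ] 𝓢(V, ℂ)).map_smul a Φ
  theta_add := fun Φ Ψ x => thetaSD_add V L m hc Φ Ψ x
  theta_smul := fun a Φ x => thetaSD_smul V L m hc a Φ x
  zero_mem := Set.mem_univ _
  add_mem := fun _ _ => Set.mem_univ _
  smul_mem := fun _ _ _ => Set.mem_univ _

/-- The topological-vector-space instances of `S(X) = 𝓢(V, ℂ)` seen through the model (for the rescaling /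
chain-rule lemmas of `WeilThetaModelDerivCalculus`, which ask `[ContinuousSMul ℂ M.W.SX]` etc.). -/
instance continuousSMul_adjoinCenterModel :
    ContinuousSMul ℂ (adjoinCenterModel V L m hφc hc Γz hΓz Γ hΓ).W.SX :=
  inferInstanceAs (ContinuousSMul ℂ 𝓢(V, ℂ))

/-- (Ported verbatim from the HodgeCMPerL package; no docstring in the source.) -/
instance continuousAdd_adjoinCenterModel :
    ContinuousAdd (adjoinCenterModel V L m hφc hc Γz hΓz Γ hΓ).W.SX :=
  inferInstanceAs (ContinuousAdd 𝓢(V, ℂ))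

/-- (Ported verbatim from the HodgeCMPerL package; no docstring in the source.) -/
instance isTopologicalAddGroup_adjoinCenterModel :
    IsTopologicalAddGroup (adjoinCenterModel V L m hφc hc Γz hΓz Γ hΓ).W.SX :=
  inferInstanceAs (IsTopologicalAddGroup 𝓢(V, ℂ))

/-- (Ported verbatim from the HodgeCMPerL package; no docstring in the source.) -/
instance t2Space_adjoinCenterModel : T2Space (adjoinCenterModel V L m hφc hc Γz hΓz Γ hΓ).W.SX :=
  inferInstanceAs (T2Space 𝓢(V, ℂ))

/-! ## 4. The derivative dictionary: `smooth` clauses of the model = Schwartz-topology derivatives of `π` / `ρ_m` -/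

/-- **`HasSKDerivAt` along ANY curve of the model, read in `𝓢(V, ℂ)`** (complex difference quotients at `0`). -/
theorem hasSKDerivAt_adjoinCenterModel_zero_iff (x : ℝ → Heis V ⋊[φ] D) (Φ Ψ : 𝓢(V, ℂ)) :
    (adjoinCenterModel V L m hφc hc Γz hΓz Γ hΓ).HasSKDerivAt
        (fun s => (adjoinCenterModel V L m hφc hc Γz hΓz Γ hΓ).omg (x s) ⟨Φ, Set.mem_univ Φ⟩)
        ⟨Ψ, Set.mem_univ Ψ⟩ 0 ↔
      Tendsto (fun s : ℝ => ((s : ℝ) : ℂ)⁻¹ •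
          ((repSD V m hc (x s) : 𝓢(V, ℂ) →L[ℂ] 𝓢(V, ℂ)) Φ - (repSD V m hc (x 0) : 𝓢(V, ℂ) →L[ℂ] 𝓢(V, ℂ)) Φ))
        (𝓝[≠] 0) (𝓝 Ψ) := by
  rw [WeilThetaModel.hasSKDerivAt_zero_iff_tendsto_coe_smul, Topology.IsInducing.subtypeVal.tendsto_nhds_iff]
  simp only [Function.comp_def, WeilThetaModel.coe_smul, WeilThetaModel.coe_sub, adjoinCenterModel_omg_mk]
  exact Iff.rfl

/-- **The `smooth` clause along an ADJOINED one-parameter family `s ↦ inr (d s)` is exactly the Schwartz-topology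
derivative of the operator family `s ↦ π_{d s} Φ`.** -/
theorem hasSKDerivAt_adjoinCenterModel_inr_iff (d : ℝ → D) (Φ Ψ : 𝓢(V, ℂ)) :
    (adjoinCenterModel V L m hφc hc Γz hΓz Γ hΓ).HasSKDerivAt
        (fun s => (adjoinCenterModel V L m hφc hc Γz hΓz Γ hΓ).omg (SemidirectProduct.inr (d s))
          ⟨Φ, Set.mem_univ Φ⟩)
        ⟨Ψ, Set.mem_univ Ψ⟩ 0 ↔
      Tendsto (fun s : ℝ => ((s : ℝ) : ℂ)⁻¹ •
          ((π (d s) : 𝓢(V, ℂ) →L[ℂ] 𝓢(V, ℂ)) Φ - (π (d 0) : 𝓢(V, ℂ) →L[ℂ] 𝓢(V, ℂ)) Φ))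
        (𝓝[≠] 0) (𝓝 Ψ) := by
  rw [hasSKDerivAt_adjoinCenterModel_zero_iff]
  simp only [repSD_inr]

/-- The same along a Heisenberg one-parameter family `s ↦ inl (h s)`: the Schwartz-topology derivative of
`s ↦ ρ_m(h s) Φ` (for `h = γ_{a,b,c}` this is pv14-g6 `tendsto_repCLM_expCurve_sub_div`, cf.
`KernelModelHeisenbergDeriv`). -/
theorem hasSKDerivAt_adjoinCenterModel_inl_iff (h : ℝ → Heis V) (Φ Ψ : 𝓢(V, ℂ)) :
    (adjoinCenterModel V L m hφc hc Γz hΓz Γ hΓ).HasSKDerivAt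
        (fun s => (adjoinCenterModel V L m hφc hc Γz hΓz Γ hΓ).omg (SemidirectProduct.inl (h s))
          ⟨Φ, Set.mem_univ Φ⟩)
        ⟨Ψ, Set.mem_univ Ψ⟩ 0 ↔
      Tendsto (fun s : ℝ => ((s : ℝ) : ℂ)⁻¹ • (repCLM V m (h s) Φ - repCLM V m (h 0) Φ))
        (𝓝[≠] 0) (𝓝 Ψ) := by
  rw [hasSKDerivAt_adjoinCenterModel_zero_iff]
  simp only [repSD_inl_apply]

/-- **Every Schwartz vector is a differentiable vector along every Heisenberg direction of the model**, with
derivative pv14-g6's `dρ_m(a,b,c)Φ` (transport of `hasSKDerivAt_centerModel_expCurve`: `ρ̃ ∘ inl = ρ_m`). -/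
theorem hasSKDerivAt_adjoinCenterModel_inl_expCurve (a b : V) (c : ℝ) (Φ : 𝓢(V, ℂ)) :
    (adjoinCenterModel V L m hφc hc Γz hΓz Γ hΓ).HasSKDerivAt
      (fun s => (adjoinCenterModel V L m hφc hc Γz hΓz Γ hΓ).omg
        (SemidirectProduct.inl (Heis.expCurve a b c s)) ⟨Φ, Set.mem_univ Φ⟩)
      ⟨schrodingerGen V m a b c Φ, Set.mem_univ _⟩ 0 := by
  rw [hasSKDerivAt_adjoinCenterModel_inl_iff, schrodingerGen_def]
  refine (tendsto_repCLM_expCurve_sub_div V m a b c Φ).congr fun s => ?_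
  rw [Heis.expCurve_zero, repCLM_one_apply, HeisenbergKernel.coe_inv_smul_schwartz]

end Model

end SchwartzWeil
end HodgeCM
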